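import Literature.Geometry.Lorentzian.AchronalBoundaryProofs
import Literature.Geometry.Lorentzian.Stationary
import Mathlib.Geometry.Manifold.IntegralCurve.Transform
import HarnessLib

/-!
# Crux `HawkingExtensionIsKerr` (stmt-FinalStateConjecture-17840), line `SketchIdeator2` —
# programme HR (horizon regularity), assembly preparations

Helper file of the line lead (c4): small bricks for the assembly of the local defining functions
of the event horizon `𝓔⁺ = ∂I⁻(M_ext) ∩ I⁺(M_ext)` of a `StationaryAFBlackHole` from the HR steps
(sandwich, height derivative, slope field, bootstrap):

* `hrPrep_isFutureSet_compl_past` & co. — `P = I⁻(M_ext)` is an open past set, `S = Pᶜ` a future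
  set with the same frontier, `int Sᶜ = P`, and `𝓔⁺ = ∂S ∩ I⁺(M_ext)`;
* `hrPrep_exists_futureNull_curve` — at a horizon point the tangent null field `K` or its negative
  is FUTURE-directed, and the (possibly reversed) short integral curve through the point has that
  velocity and stays in the horizon (input form of the null sandwich HR-S);
* `hrPrep_norm_lt_of_box` — chart points of the box are `ρ`-close to the centre;
* `hrPrep_deriv_formula` — the linear algebra turning the derivative `ℓ − Du ∘ A` of the defining
  function `F = ℓ − u ∘ A` into `(Λ v)⁻¹ Λ` when `Du = −(Λ v)⁻¹ Λ ∘ B` and `B ∘ A + v ⊗ ℓ = id`.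
-/

noncomputable section

set_option linter.dupNamespace false

namespace Summit.FinalStateConjecture.FinalStateConjecture.Theorems.HawkingExtensionIsKerr.SketchIdeator2

open Set Filter Metric Bundle Function Literature.Geometry.Lorentzian LorentzianMetric
open scoped Manifold ContDiff Topology

/-! ### The past set `I⁻(M_ext)`, its complement and the horizon -/

/-- `I⁻(M_ext)` is open (space-time without boundary). [folklore] -/
theorem hrPrep_isOpen_past (𝓑 : StationaryAFBlackHole.{0}) :
    IsOpen (𝓑.metric.chronologicalPast 𝓑.timeOrientation 𝓑.Mext) :=
  isOpen_chronologicalPast_of_boundaryless 𝓑.metric 𝓑.timeOrientation _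

/-- `I⁺(M_ext)` is open (space-time without boundary). [folklore] -/
theorem hrPrep_isOpen_future (𝓑 : StationaryAFBlackHole.{0}) :
    IsOpen (𝓑.metric.chronologicalFuture 𝓑.timeOrientation 𝓑.Mext) :=
  isOpen_chronologicalFuture_of_boundaryless 𝓑.metric 𝓑.timeOrientation _

/-- The complement of the past set `I⁻(M_ext)` is a future set (Hawking–Ellis 1973, §6.3).
[cite: HawkingEllis1973, §6.3, p. 186] -/
theorem hrPrep_isFutureSet_compl_past (𝓑 : StationaryAFBlackHole.{0}) :
    𝓑.metric.IsFutureSet 𝓑.timeOrientation (𝓑.metric.chronologicalPast 𝓑.timeOrientation 𝓑.Mext)ᶜ :=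
  (isPastSet_chronologicalPast (g := 𝓑.metric) (τ := 𝓑.timeOrientation) 𝓑.Mext).isFutureSet_compl

/-- The interior of the complement of the complement of the open past set `I⁻(M_ext)` is
`I⁻(M_ext)` itself. [folklore] -/
theorem hrPrep_interior_compl_compl (𝓑 : StationaryAFBlackHole.{0}) :
    interior (𝓑.metric.chronologicalPast 𝓑.timeOrientation 𝓑.Mext)ᶜᶜ =
      𝓑.metric.chronologicalPast 𝓑.timeOrientation 𝓑.Mext := by
  rw [compl_compl, (hrPrep_isOpen_past 𝓑).interior_eq]

/-- The horizon is the part of the frontier of `S = (I⁻(M_ext)))ᶜ` inside `I⁺(M_ext)`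
(`𝓔⁺ = ∂I⁻(M_ext) ∩ I⁺(M_ext)` and `∂Sᶜ = ∂S`). [folklore] -/
theorem hrPrep_mem_horizon_iff (𝓑 : StationaryAFBlackHole.{0}) (x : 𝓑.carrier) :
    x ∈ 𝓑.horizon ↔ x ∈ frontier (𝓑.metric.chronologicalPast 𝓑.timeOrientation 𝓑.Mext)ᶜ ∧
      x ∈ 𝓑.metric.chronologicalFuture 𝓑.timeOrientation 𝓑.Mext := by
  rw [frontier_compl]
  exact Iff.rfl

/-- A point of the open past set `I⁻(M_ext)` is not on its frontier. [folklore] -/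
theorem hrPrep_not_mem_frontier_of_mem_past (𝓑 : StationaryAFBlackHole.{0}) {x : 𝓑.carrier}
    (hx : x ∈ 𝓑.metric.chronologicalPast 𝓑.timeOrientation 𝓑.Mext) :
    x ∉ frontier (𝓑.metric.chronologicalPast 𝓑.timeOrientation 𝓑.Mext) := by
  rw [(hrPrep_isOpen_past 𝓑).frontier_eq]
  exact fun h ↦ h.2 hx

/-- A point of `S = (I⁻(M_ext))ᶜ` on the frontier is not in the interior of `S`. [folklore] -/
theorem hrPrep_not_mem_past_of_mem_interior_compl (𝓑 : StationaryAFBlackHole.{0}) {x : 𝓑.carrier}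
    (hx : x ∈ interior (𝓑.metric.chronologicalPast 𝓑.timeOrientation 𝓑.Mext)ᶜ) :
    x ∉ 𝓑.metric.chronologicalPast 𝓑.timeOrientation 𝓑.Mext :=
  fun h ↦ interior_subset hx h

/-! ### Future-directed null data at a horizon point -/

/-- **A short integral curve of `K` through `x₀` has velocity `K x₀` at `0`.** [folklore] -/
theorem hrPrep_hasMFDerivAt_of_isMIntegralCurveOn {𝓑 : StationaryAFBlackHole.{0}}
    {K : Π x : 𝓑.carrier, TangentSpace (𝓡 4) x} {γ : ℝ → 𝓑.carrier} {ε : ℝ} (hε : 0 < ε)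
    (hγ : IsMIntegralCurveOn γ K (Ioo (-ε) ε)) :
    HasMFDerivAt 𝓘(ℝ, ℝ) (𝓡 4) γ 0 ((1 : ℝ →L[ℝ] ℝ).smulRight (K (γ 0))) :=
  (hγ 0 ⟨by linarith, hε⟩).hasMFDerivAt (Ioo_mem_nhds (by linarith) hε)

/-- **The reversed curve `t ↦ γ(−t)` of a short integral curve of `K` through `x₀` has velocity
`−K x₀` at `0` and runs through the same points.** (Mathlib `IsMIntegralCurveOn.comp_mul` with
factor `−1`.) [folklore] -/
theorem hrPrep_reversed_curve {𝓑 : StationaryAFBlackHole.{0}}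
    {K : Π x : 𝓑.carrier, TangentSpace (𝓡 4) x} {γ : ℝ → 𝓑.carrier} {ε : ℝ} (hε : 0 < ε)
    (hγ : IsMIntegralCurveOn γ K (Ioo (-ε) ε)) {A : Set 𝓑.carrier}
    (hA : ∀ t ∈ Ioo (-ε) ε, γ t ∈ A) :
    (γ ∘ (· * (-1 : ℝ))) 0 = γ 0 ∧
      HasMFDerivAt 𝓘(ℝ, ℝ) (𝓡 4) (γ ∘ (· * (-1 : ℝ))) 0 ((1 : ℝ →L[ℝ] ℝ).smulRight (-K (γ 0))) ∧
      ∀ t ∈ Ioo (-ε) ε, (γ ∘ (· * (-1 : ℝ))) t ∈ A := by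
  have h0 : (γ ∘ (· * (-1 : ℝ))) 0 = γ 0 := by simp
  refine ⟨h0, ?_, fun t ht ↦ hA _ ⟨by simp only [mul_neg, mul_one]; linarith [ht.2],
    by simp only [mul_neg, mul_one]; linarith [ht.1]⟩⟩
  have h := hγ.comp_mul (-1 : ℝ)
  have hmem : (0 : ℝ) ∈ {t : ℝ | t * (-1 : ℝ) ∈ Ioo (-ε) ε} := by
    simp only [mem_setOf_eq, zero_mul]; exact ⟨by linarith, hε⟩
  have hnhds : {t : ℝ | t * (-1 : ℝ) ∈ Ioo (-ε) ε} ∈ 𝓝 (0 : ℝ) := by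
    have : {t : ℝ | t * (-1 : ℝ) ∈ Ioo (-ε) ε} = Ioo (-ε) ε := by
      ext t; simp only [mem_setOf_eq, mem_Ioo, mul_neg, mul_one]; constructor <;> intro ht <;>
        constructor <;> linarith [ht.1, ht.2]
    rw [this]; exact Ioo_mem_nhds (by linarith) hε
  have h2 := (h 0 hmem).hasMFDerivAt hnhds
  simp only [comp_apply, Pi.smul_apply, neg_smul, one_smul] at h2
  rw [h0]
  have e0 : γ (0 * -1) = γ 0 := by rw [zero_mul]
  rw [e0] at h2
  exact h2

/-- **Future-directed null data at a horizon point.**  If `K x₀` is null and non-zero and a short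
integral curve of `K` through `x₀` stays in a set `A`, then `L := K x₀` or `L := −K x₀` is a
FUTURE-directed null vector (a causal vector is never orthogonal to the timelike orientation field,
O'Neill 1983 Lemma 5.26) and some curve through `x₀` with velocity `L` at `0` stays in `A` on the
same parameter interval. [cite: ONeillSemiRiemannian1983, Ch. 5, Lemma 5.26] -/
theorem hrPrep_exists_futureNull_curve {𝓑 : StationaryAFBlackHole.{0}}
    {K : Π x : 𝓑.carrier, TangentSpace (𝓡 4) x} {x₀ : 𝓑.carrier} (hK0 : K x₀ ≠ 0)
    (hKnull : 𝓑.metric.val x₀ (K x₀) (K x₀) = 0) {γ : ℝ → 𝓑.carrier} {ε : ℝ} (hε : 0 < ε)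
    (hγ0 : γ 0 = x₀) (hγ : IsMIntegralCurveOn γ K (Ioo (-ε) ε)) {A : Set 𝓑.carrier}
    (hA : ∀ t ∈ Ioo (-ε) ε, γ t ∈ A) :
    ∃ (L : TangentSpace (𝓡 4) x₀) (γ' : ℝ → 𝓑.carrier), (L = K x₀ ∨ L = -K x₀) ∧
      𝓑.metric.val x₀ L L = 0 ∧ 𝓑.metric.val x₀ (𝓑.timeOrientation.vectorField x₀) L < 0 ∧
      γ' 0 = x₀ ∧ HasMFDerivAt 𝓘(ℝ, ℝ) (𝓡 4) γ' 0 ((1 : ℝ →L[ℝ] ℝ).smulRight L) ∧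
      ∀ t ∈ Ioo (-ε) ε, γ' t ∈ A := by
  have hne : 𝓑.metric.val x₀ (𝓑.timeOrientation.vectorField x₀) (K x₀) ≠ 0 :=
    𝓑.metric.val_ne_zero_of_isTimelike_of_isCausal (𝓑.timeOrientation.isTimelike x₀)
      ⟨le_of_eq hKnull, hK0⟩
  subst hγ0
  rcases lt_or_gt_of_ne hne with hlt | hgt
  · exact ⟨K (γ 0), γ, Or.inl rfl, hKnull, hlt, rfl,
      hrPrep_hasMFDerivAt_of_isMIntegralCurveOn hε hγ, hA⟩
  · obtain ⟨h0, hd, hA'⟩ := hrPrep_reversed_curve hε hγ hA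
    refine ⟨-K (γ 0), γ ∘ (· * (-1 : ℝ)), Or.inr rfl, ?_, ?_, h0, hd, hA'⟩
    · simp only [map_neg, neg_apply, neg_neg]; exact hKnull
    · simp only [map_neg]; linarith

/-! ### Elementary estimates and linear algebra of the box -/

/-- **Chart points of the box are `ρ`-close to the centre**: if `w = B (A w) + ℓ(w) v` with
`‖B (A w)‖ < ε ≤ ρ/2` and `|ℓ w| < δ`, `δ ‖v‖ ≤ ρ/2`, then `‖w‖ < ρ`. [folklore] -/
theorem hrPrep_norm_lt_of_box {V : Type*} [NormedAddCommGroup V] [NormedSpace ℝ V]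
    {w bw v : V} {l ε δ ρ : ℝ} (hw : bw + l • v = w) (hbw : ‖bw‖ < ε) (hl : |l| < δ)
    (hε : ε ≤ ρ / 2) (hδv : δ * ‖v‖ ≤ ρ / 2) : ‖w‖ < ρ := by
  rw [← hw]
  calc ‖bw + l • v‖ ≤ ‖bw‖ + ‖l • v‖ := norm_add_le _ _
    _ = ‖bw‖ + |l| * ‖v‖ := by rw [norm_smul, Real.norm_eq_abs]
    _ ≤ ‖bw‖ + δ * ‖v‖ := by gcongr
    _ < ε + ρ / 2 := by linarith
    _ ≤ ρ := by linarith

/-- **The derivative of the defining function.**  With the transverse splitting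
`B (A w) + ℓ(w) v = w` and a linear functional `Λ` with `Λ v ≠ 0`, the form
`ℓ − ℓ₁ ∘ A`, `ℓ₁ = −(Λ v)⁻¹ Λ ∘ B` (the derivative of `t − u(y)` when `Du = ℓ₁`), equals
`(Λ v)⁻¹ Λ`. [folklore] -/
theorem hrPrep_deriv_formula {V W : Type*} [NormedAddCommGroup V] [NormedSpace ℝ V]
    [NormedAddCommGroup W] [NormedSpace ℝ W] {A : V →L[ℝ] W} {B : W →L[ℝ] V} {ℓ Λ : V →L[ℝ] ℝ}
    {v : V} (hBA : ∀ z, B (A z) + ℓ z • v = z) (hΛv : Λ v ≠ 0) (w : V) :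
    ℓ w - (-(Λ v)⁻¹ • (Λ.comp B)) (A w) = (Λ v)⁻¹ * Λ w := by
  have h : Λ w = Λ (B (A w)) + ℓ w * Λ v := by
    conv_lhs => rw [← hBA w]
    rw [map_add, map_smul, smul_eq_mul]
  simp only [FunLike.coe_smul, Pi.smul_apply, ContinuousLinearMap.comp_apply, smul_eq_mul]
  rw [h]
  field_simp
  ring

/-- **Registered sub-goal form of the future-directed null data** (closed statement, crux
stmt-FinalStateConjecture-17840): at a point where `K` is null and non-zero, `K` or `−K` is
future-directed and a (possibly reversed) short integral curve of `K` through the point has that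
velocity and stays in the given set. -/
theorem stub_hr_futureNull : ∀ (𝓑 : StationaryAFBlackHole.{0}) (K : Π x : 𝓑.carrier, TangentSpace (𝓡 4) x) (x₀ : 𝓑.carrier) (γ : ℝ → 𝓑.carrier) (ε : ℝ) (A : Set 𝓑.carrier), K x₀ ≠ 0 → 𝓑.metric.val x₀ (K x₀) (K x₀) = 0 → 0 < ε → γ 0 = x₀ → IsMIntegralCurveOn γ K (Set.Ioo (-ε) ε) → (∀ t ∈ Set.Ioo (-ε) ε, γ t ∈ A) → ∃ (L : TangentSpace (𝓡 4) x₀) (γ' : ℝ → 𝓑.carrier), (L = K x₀ ∨ L = -K x₀) ∧ 𝓑.metric.val x₀ L L = 0 ∧ 𝓑.metric.val x₀ (𝓑.timeOrientation.vectorField x₀) L < 0 ∧ γ' 0 = x₀ ∧ HasMFDerivAt 𝓘(ℝ, ℝ) (𝓡 4) γ' 0 ((1 : ℝ →L[ℝ] ℝ).smulRight L) ∧ ∀ t ∈ Set.Ioo (-ε) ε, γ' t ∈ A :=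
  fun _ _ _ _ _ _ hK0 hKnull hε hγ0 hγ hA ↦ hrPrep_exists_futureNull_curve hK0 hKnull hε hγ0 hγ hA

end Summit.FinalStateConjecture.FinalStateConjecture.Theorems.HawkingExtensionIsKerr.SketchIdeator2

end
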